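import Summits.Parity.BatemanHorn.Theorems.SoloInformedHooleyMeanLocal
import Summits.Parity.BatemanHorn.Theorems.SoloInformedKernelVariation

/-!
# The trapezoid method: the estimate on one dyadic block of moduli

Informed soloist `solo-Parity-informed` (session 143), conjunct `BatemanHorn`, the `d ≥ 3` rung BELOW the parity
wall.  For one dyadic block of moduli `E < e ≤ E' ≤ 2E` we bound the trapezoid error functional of
`SoloInformedTrapezoidReduction`,
`Z(E, E'] = ∑_{E<e≤E'} (1/e) ∑_{0<h<e} K_e(h)·S_g(h; e)`,   `K_e(h) = ∑_m W(m)a_e(m)e(−hm/e)`,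
by `2·[(D/2 + W₁)·L₁ + W₂·L₀/E²] + V·E'²·R/(4(H+1))` (`norm_trapBlock_le`), where
* `L₀ = C·H·E^{1−η}`, `L₁ = C·E^{1−η}(2 + log H)` come from the local `ℓ¹`-mean hypothesis for the Hooley sums on
  the block with `H ≤ E^θ` frequencies (`SoloInformedHooleyMeanLocal`),
* `W₁ = D/(2Δ) + (π/8)(N·V + 4D) + D/2`, `W₂ = π²D(N+1)/4` (`N = X₀ + D + 2`) bound the variation
  `|c_{e+1}(h) − c_e(h)| ≤ W₁/(e|h|) + W₂/e³` of the Abel coefficients `c_e(h) = K_e(h)/e` (`norm_trapCoef_succ_sub_le`: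
  weight variation at first order, phase variation at SECOND order — `SoloInformedKernelVariation`),
* `V = 2 + D·C₁/(2Δ(X₀+1)) + D(C₂+4C₁)/(2ΔA)` bounds the second variation of the weights
  (`SoloInformedTrapezoidSecondVariation`; `A + 1` = a common vanishing range of `a_e`, `e ≥ E`), and
* `R = ∑_{E<e≤E'} ρ_g(e)/e` carries the frequency TAIL `|h| > H`, treated termwise by the `h⁻²` decay.
The decomposition `Z = main₊ + main₋ + tail` is `trapBlock_eq` (fold of `0 < h < e` into `±h`, split at `H`). -/

namespace Summit.Parity.BatemanHorn.Theorems

open Finset Polynomial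
open Literature.NumberTheory.Sieve (polyRootCountMod)

/-! ### The Abel coefficients `c_e(h) = K_e(h)/e` -/
/-- The kernel sum of the block, `K_e(h) = K_N(Φ_e; e(−h/e))`, `N = X₀ + D + 2`. [this work] -/
noncomputable def trapKs (g : ℤ[X]) (Δ : ℝ) (X₀ D e : ℕ) (h : ℤ) : ℂ :=
  kernelSum (X₀ + D + 2) (trapPhi g Δ X₀ D e) (eAdd e (-h))

/-- The Abel coefficient `c_e(h) = K_e(h)/e`. [this work] -/
noncomputable def trapCoef (g : ℤ[X]) (Δ : ℝ) (X₀ D e : ℕ) (h : ℤ) : ℂ :=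
  trapKs g Δ X₀ D e h / (e : ℂ)

/-- `(1/e)·(K_e(h)·S) = c_e(h)·S`. [this work] -/
theorem one_div_mul_trapK_mul (g : ℤ[X]) (Δ : ℝ) (X₀ D e : ℕ) (h : ℤ) (S : ℂ) :
    1 / (e : ℂ) * (trapKs g Δ X₀ D e h * S) = trapCoef g Δ X₀ D e h * S := by
  unfold trapCoef; ring

/-- **`|c_e(h)| ≤ D/(2|h|)`** (`h ≠ 0`, `2|h| ≤ e`). [this work] -/
theorem norm_trapCoef_le (g : ℤ[X]) {Δ : ℝ} (hΔ : 0 < Δ) (X₀ D : ℕ) {e : ℕ} (he : 1 ≤ e)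
    (hz : ∀ k : ℕ, g.eval (k : ℤ) ≠ 0) {m₀ A : ℕ} (hA : m₀ ≤ A)
    (hmono : ∀ m m' : ℕ, m₀ ≤ m → m ≤ m' → (g.eval (m : ℤ)).natAbs ≤ (g.eval (m' : ℤ)).natAbs)
    (hvan : ∀ m : ℕ, m ≤ A + 1 → locWeight g Δ e m = 0) {h : ℤ} (h0 : h ≠ 0) (h2 : 2 * |h| ≤ (e : ℤ)) :
    ‖trapCoef g Δ X₀ D e h‖ ≤ (D : ℝ) / (2 * |(h : ℝ)|) := by
  have he' : (0 : ℝ) < e := by exact_mod_cast he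
  have habs : (0 : ℝ) < |(h : ℝ)| := abs_pos.mpr (by exact_mod_cast h0)
  unfold trapCoef trapKs
  rw [norm_div, Complex.norm_natCast, div_le_iff₀ he']
  calc ‖kernelSum (X₀ + D + 2) (trapPhi g Δ X₀ D e) (eAdd e (-h))‖ ≤ (D : ℝ) * e / (2 * |(h : ℝ)|) :=
        norm_trapKernelSum_le_first g hΔ X₀ D he hz hA hmono hvan h0 h2
    _ = (D : ℝ) / (2 * |(h : ℝ)|) * e := by field_simp

/-- The identity `c_{e+1}(h) − c_e(h) = (K_N(Ψ_e; e(−h/(e+1))) + K_N(Φ_e(ξ^· − 1); e(−h/e)))/(e+1) − K_e(h)/(e(e+1))`.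
[this work] -/
theorem trapCoef_succ_sub_eq (g : ℤ[X]) (Δ : ℝ) (X₀ D : ℕ) {e : ℕ} (he : e ≠ 0) (h : ℤ) :
    trapCoef g Δ X₀ D (e + 1) h - trapCoef g Δ X₀ D e h
      = (kernelSum (X₀ + D + 2) (trapPsi g Δ X₀ D e) (eAdd (e + 1) (-h))
          + kernelSum (X₀ + D + 2) (fun m => trapPhi g Δ X₀ D e m * (eAdd (e * (e + 1)) h ^ m - 1))
              (eAdd e (-h))) / ((e : ℂ) + 1)
        - trapKs g Δ X₀ D e h / ((e : ℂ) * ((e : ℂ) + 1)) := by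
  have hdiff : trapKs g Δ X₀ D (e + 1) h - trapKs g Δ X₀ D e h
      = kernelSum (X₀ + D + 2) (trapPsi g Δ X₀ D e) (eAdd (e + 1) (-h))
        + kernelSum (X₀ + D + 2) (fun m => trapPhi g Δ X₀ D e m * (eAdd (e * (e + 1)) h ^ m - 1))
            (eAdd e (-h)) := by
    have h1 := kernelSum_succ_modulus_sub (X₀ + D + 2) (trapPhi g Δ X₀ D e) (trapPhi g Δ X₀ D (e + 1)) he h
    have h2 : (fun m => trapPhi g Δ X₀ D (e + 1) m - trapPhi g Δ X₀ D e m) = trapPsi g Δ X₀ D e :=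
      funext fun m => (trapPsi_eq_sub g Δ X₀ D e m).symm
    rw [h2] at h1
    simpa only [trapKs] using h1
  rw [← hdiff]
  have heC : (e : ℂ) ≠ 0 := by exact_mod_cast he
  have heC1 : (e : ℂ) + 1 ≠ 0 := by
    have : ((e + 1 : ℕ) : ℂ) ≠ 0 := by exact_mod_cast (by omega : e + 1 ≠ 0)
    simpa using this
  unfold trapCoef
  push_cast
  field_simp
  ring

/-- Real arithmetic of the coefficient variation. [this work] -/
theorem coef_variation_aux {D Δ σ x e P₁ P₂ nΨ nφ nK : ℝ} (hΔ : 0 < Δ) (hx : 0 < x) (he : 1 ≤ e)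
    (hD : 0 ≤ D) (hP₁ : 0 ≤ P₁) (hP₂ : 0 ≤ P₂) (hσ : σ ≤ 1 / (2 * Δ * e))
    (hΨ : nΨ ≤ D * (e + 1) * σ / x) (hφ : nφ ≤ P₁ / x + P₂ / e ^ 2) (hK : nK ≤ D * e / (2 * x)) :
    (nΨ + nφ) / (e + 1) + nK / (e * (e + 1)) ≤ (D / (2 * Δ) + P₁ + D / 2) / (e * x) + P₂ / e ^ 3 := by
  have he0 : 0 < e := by linarith
  have step1 : (nΨ + nφ) / (e + 1) + nK / (e * (e + 1))
      ≤ (D * (e + 1) * σ / x + (P₁ / x + P₂ / e ^ 2)) / (e + 1) + (D * e / (2 * x)) / (e * (e + 1)) :=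
    add_le_add (div_le_div_of_nonneg_right (add_le_add hΨ hφ) (by positivity))
      (div_le_div_of_nonneg_right hK (by positivity))
  refine step1.trans ?_
  have eq2 : (D * (e + 1) * σ / x + (P₁ / x + P₂ / e ^ 2)) / (e + 1) + (D * e / (2 * x)) / (e * (e + 1))
      = D * σ / x + P₁ / (x * (e + 1)) + P₂ / (e ^ 2 * (e + 1)) + D / (2 * (x * (e + 1))) := by
    field_simp
    ring
  rw [eq2]
  have t1 : D * σ / x ≤ D / (2 * Δ) / (e * x) := by
    rw [div_le_div_iff₀ hx (by positivity)]
    calc D * σ * (e * x) = (D * x) * (σ * e) := by ring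
      _ ≤ (D * x) * (1 / (2 * Δ * e) * e) :=
          mul_le_mul_of_nonneg_left (mul_le_mul_of_nonneg_right hσ he0.le) (by positivity)
      _ = D / (2 * Δ) * x := by field_simp
  have hxe : e * x ≤ x * (e + 1) := by nlinarith
  have t2 : P₁ / (x * (e + 1)) ≤ P₁ / (e * x) := div_le_div_of_nonneg_left hP₁ (by positivity) hxe
  have he3 : e ^ 3 ≤ e ^ 2 * (e + 1) := by nlinarith [sq_nonneg e]
  have t3 : P₂ / (e ^ 2 * (e + 1)) ≤ P₂ / e ^ 3 := div_le_div_of_nonneg_left hP₂ (by positivity) he3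
  have t4 : D / (2 * (x * (e + 1))) ≤ D / 2 / (e * x) := by
    rw [div_div]
    exact div_le_div_of_nonneg_left hD (by positivity) (by nlinarith)
  have eq3 : (D / (2 * Δ) + P₁ + D / 2) / (e * x) + P₂ / e ^ 3
      = D / (2 * Δ) / (e * x) + P₁ / (e * x) + P₂ / e ^ 3 + D / 2 / (e * x) := by
    field_simp
    ring
  rw [eq3]
  linarith

/-- **Variation of the Abel coefficients**:
`|c_{e+1}(h) − c_e(h)| ≤ (D/(2Δ) + (π/8)(N·V + 4D) + D/2)/(e|h|) + π²D(N+1)/(4e³)`, `N = X₀ + D + 2`,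
`V = 2 + D·C₁/(2Δ(X₀+1)) + D(C₂+4C₁)/(2ΔA)` (`h ≠ 0`, `2|h| ≤ e`; vanishing of `a_e` on `m ≤ A + 1`). [this work] -/
theorem norm_trapCoef_succ_sub_le (g : ℤ[X]) {Δ : ℝ} (hΔ : 0 < Δ) (X₀ D : ℕ) {e : ℕ} (he : 1 ≤ e)
    (hz : ∀ k : ℕ, g.eval (k : ℤ) ≠ 0) {m₀ A : ℕ} (hA : m₀ ≤ A) (hA1 : 1 ≤ A)
    (hmono : ∀ m m' : ℕ, m₀ ≤ m → m ≤ m' → (g.eval (m : ℤ)).natAbs ≤ (g.eval (m' : ℤ)).natAbs)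
    (hvan : ∀ m : ℕ, m ≤ A + 1 → locWeight g Δ e m = 0) {C₁ C₂ : ℝ}
    (hC₁ : ∀ m : ℕ, 1 ≤ m →
      |Real.log ((g.eval ((m : ℤ) + 1)).natAbs : ℝ) - Real.log ((g.eval (m : ℤ)).natAbs : ℝ)| ≤ C₁ / m)
    (hC₂ : ∀ m : ℕ, 1 ≤ m →
      |Real.log ((g.eval ((m : ℤ) + 2)).natAbs : ℝ) - 2 * Real.log ((g.eval ((m : ℤ) + 1)).natAbs : ℝ)
        + Real.log ((g.eval (m : ℤ)).natAbs : ℝ)| ≤ C₂ / (m : ℝ) ^ 2)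
    {h : ℤ} (h0 : h ≠ 0) (h2 : 2 * |h| ≤ (e : ℤ)) :
    ‖trapCoef g Δ X₀ D (e + 1) h - trapCoef g Δ X₀ D e h‖
      ≤ ((D : ℝ) / (2 * Δ) + Real.pi / 8 * (((X₀ + D + 2 : ℕ) : ℝ)
            * (2 + D * C₁ / (2 * Δ * ((X₀ : ℝ) + 1)) + D * ((C₂ + 4 * C₁) / (2 * Δ * A))) + 4 * D) + D / 2)
          / ((e : ℝ) * |(h : ℝ)|)
        + Real.pi ^ 2 * D * ((X₀ + D + 3 : ℕ) : ℝ) / (4 * (e : ℝ) ^ 3) := by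
  have he0 : e ≠ 0 := by omega
  have he' : (1 : ℝ) ≤ e := by exact_mod_cast he
  have habs : (0 : ℝ) < |(h : ℝ)| := abs_pos.mpr (by exact_mod_cast h0)
  have hC₁0 : 0 ≤ C₁ := by have := hC₁ 1 le_rfl; simp at this; exact (abs_nonneg _).trans this
  have hC₂0 : 0 ≤ C₂ := by have := hC₂ 1 le_rfl; simp at this; exact (abs_nonneg _).trans this
  have hV0 : 0 ≤ 2 + D * C₁ / (2 * Δ * ((X₀ : ℝ) + 1)) + D * ((C₂ + 4 * C₁) / (2 * Δ * A)) := by positivity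
  -- the three kernel bounds
  have hΨ := norm_trapKernelSum_psi_le g hΔ X₀ D he hz hA hmono hvan h0 (by push_cast; omega)
  have hφ := norm_trapKernelSum_phase_le g hΔ X₀ D he hz hA hmono hvan
      (sum_norm_bdiff_bdiff_trapPhi_le g hΔ X₀ D he hz hA hA1 hmono hvan hC₁ hC₂) h0 h2
  have hKb : ‖trapKs g Δ X₀ D e h‖ ≤ (D : ℝ) * e / (2 * |(h : ℝ)|) :=
    norm_trapKernelSum_le_first g hΔ X₀ D he hz hA hmono hvan h0 h2
  -- norms of the two pieces
  have hcast1 : ((e : ℂ) + 1) = ((e + 1 : ℕ) : ℂ) := by push_cast; ring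
  rw [trapCoef_succ_sub_eq g Δ X₀ D he0 h]
  refine (norm_sub_le _ _).trans ?_
  rw [norm_div, norm_div, norm_mul, hcast1, Complex.norm_natCast, Complex.norm_natCast]
  push_cast
  refine (add_le_add (div_le_div_of_nonneg_right (norm_add_le _ _) (by positivity)) le_rfl).trans ?_
  refine (coef_variation_aux hΔ habs he' (Nat.cast_nonneg D) (P₁ := Real.pi / 8 * (((X₀ + D + 2 : ℕ) : ℝ)
      * (2 + D * C₁ / (2 * Δ * ((X₀ : ℝ) + 1)) + D * ((C₂ + 4 * C₁) / (2 * Δ * A))) + 4 * D))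
    (P₂ := Real.pi ^ 2 * D * ((X₀ + D + 3 : ℕ) : ℝ) / 4) (by positivity) (by positivity)
    (shiftWidth_le hΔ he) hΨ (hφ.trans (le_of_eq (by ring))) hKb).trans (le_of_eq ?_)
  push_cast
  ring

/-! ### The decomposition of the block -/
/-- Splitting `1 ≤ i ≤ n` at `H ≤ n`. [folklore] -/
theorem sum_Icc_one_eq_sum_Icc_add_sum_Ioc {M : Type*} [AddCommMonoid M] (f : ℕ → M) {H n : ℕ} (hH : H ≤ n) :
    ∑ i ∈ Icc 1 n, f i = ∑ i ∈ Icc 1 H, f i + ∑ i ∈ Ioc H n, f i := by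
  rw [show Icc 1 n = Icc 1 H ∪ Ioc H n from by ext i; simp only [mem_Icc, mem_union, mem_Ioc]; omega,
    sum_union (disjoint_left.mpr fun i hi hi' => by
      rw [mem_Icc] at hi; rw [mem_Ioc] at hi'; omega)]

/-- **`Z(E,E'] = main₊ + main₋ + tail`**: for `2H + 1 ≤ E ≤ E'` and `a_e(0) = 0` on the block,
`∑_{E<e≤E'} (1/e)∑_{0<h<e} K_e(h)S_g(h;e) = ∑_{h≤H} ∑_e c_e(h)S_g(h;e) + ∑_{k≤H} ∑_e c_e(−k)S_g(−k;e)
  + ∑_e (1/e)(∑_{H<h≤(e−1)/2} K_e(h)S_g(h;e) + ∑_{H<k≤e/2} K_e(−k)S_g(−k;e))`. [this work] -/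
theorem trapBlock_eq (g : ℤ[X]) (Δ : ℝ) (X₀ D : ℕ) {E E' H : ℕ} (hH : 2 * H + 1 ≤ E)
    (hvan0 : ∀ e : ℕ, E < e → locWeight g Δ e 0 = 0) :
    ∑ e ∈ Ioc E E', 1 / (e : ℂ) * ∑ h ∈ Ico 1 e, trapKernel g Δ X₀ D e h * hooleySum g e h
      = ∑ h ∈ Icc 1 H, ∑ e ∈ Ioc E E', trapCoef g Δ X₀ D e h * hooleySum g e h
        + ∑ k ∈ Icc 1 H, ∑ e ∈ Ioc E E', trapCoef g Δ X₀ D e (-(k : ℤ)) * hooleySum g e (-(k : ℤ))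
        + ∑ e ∈ Ioc E E', 1 / (e : ℂ)
            * (∑ h ∈ Ioc H ((e - 1) / 2), trapKs g Δ X₀ D e h * hooleySum g e h
              + ∑ k ∈ Ioc H (e / 2), trapKs g Δ X₀ D e (-(k : ℤ)) * hooleySum g e (-(k : ℤ))) := by
  have per_e : ∀ e ∈ Ioc E E', 1 / (e : ℂ) * ∑ h ∈ Ico 1 e, trapKernel g Δ X₀ D e h * hooleySum g e h
      = ∑ h ∈ Icc 1 H, trapCoef g Δ X₀ D e h * hooleySum g e h
        + ∑ k ∈ Icc 1 H, trapCoef g Δ X₀ D e (-(k : ℤ)) * hooleySum g e (-(k : ℤ))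
        + 1 / (e : ℂ)
            * (∑ h ∈ Ioc H ((e - 1) / 2), trapKs g Δ X₀ D e h * hooleySum g e h
              + ∑ k ∈ Ioc H (e / 2), trapKs g Δ X₀ D e (-(k : ℤ)) * hooleySum g e (-(k : ℤ))) := by
    intro e he
    rw [mem_Ioc] at he
    have hK : ∀ h : ℤ, trapKernel g Δ X₀ D e h = trapKs g Δ X₀ D e h := fun h =>
      trapKernel_eq_kernelSum g Δ X₀ D (hvan0 e he.1) h
    rw [sum_Ico_trapKernel_mul_hooleySum_eq_fold]
    simp only [hK]
    rw [sum_Icc_one_eq_sum_Icc_add_sum_Ioc _ (show H ≤ (e - 1) / 2 by omega),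
      sum_Icc_one_eq_sum_Icc_add_sum_Ioc _ (show H ≤ e / 2 by omega)]
    simp only [mul_add, mul_sum, one_div_mul_trapK_mul]
    ring
  rw [sum_congr rfl per_e, sum_add_distrib, sum_add_distrib, sum_comm]
  congr 1
  congr 1
  exact sum_comm

/-! ### The main parts -/
/-- **The main part of one sign.**  With the block hypothesis (constant `C ≥ 0`, `H ≤ E^θ` frequencies) and the
variation bounds: `∑_{h≤H} |∑_{E<e≤E'} c_e(±h)S_g(±h;e)| ≤ (D/2 + W₁)·C E^{1−η}(2 + log H) + W₂·C·H·E^{1−η}/E²`.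
[this work] -/
theorem sum_norm_trapMain_le (g : ℤ[X]) {Δ : ℝ} (hΔ : 0 < Δ) (X₀ D : ℕ)
    (hz : ∀ k : ℕ, g.eval (k : ℤ) ≠ 0) {m₀ A : ℕ} (hA : m₀ ≤ A) (hA1 : 1 ≤ A)
    (hmono : ∀ m m' : ℕ, m₀ ≤ m → m ≤ m' → (g.eval (m : ℤ)).natAbs ≤ (g.eval (m' : ℤ)).natAbs)
    {C₁ C₂ : ℝ}
    (hC₁ : ∀ m : ℕ, 1 ≤ m →
      |Real.log ((g.eval ((m : ℤ) + 1)).natAbs : ℝ) - Real.log ((g.eval (m : ℤ)).natAbs : ℝ)| ≤ C₁ / m)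
    (hC₂ : ∀ m : ℕ, 1 ≤ m →
      |Real.log ((g.eval ((m : ℤ) + 2)).natAbs : ℝ) - 2 * Real.log ((g.eval ((m : ℤ) + 1)).natAbs : ℝ)
        + Real.log ((g.eval (m : ℤ)).natAbs : ℝ)| ≤ C₂ / (m : ℝ) ^ 2)
    {E E' H : ℕ} (hE : 1 ≤ E) (hEE' : E ≤ E') (hE'2 : E' ≤ 2 * E) (hH : 2 * H + 1 ≤ E)
    (hvan : ∀ e : ℕ, E ≤ e → ∀ m : ℕ, m ≤ A + 1 → locWeight g Δ e m = 0)
    {C θ η : ℝ} (hC0 : 0 ≤ C) (hHθ : (H : ℝ) ≤ (E : ℝ) ^ θ)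
    (hC : ∀ E₁ E₁' H₁ : ℕ, 1 ≤ E₁ → E₁ ≤ E₁' → E₁' ≤ 2 * E₁ → (H₁ : ℝ) ≤ (E₁ : ℝ) ^ θ →
      ∑ h ∈ Icc 1 H₁, (‖∑ e ∈ Ioc E₁ E₁', hooleySum g e h‖ + ‖∑ e ∈ Ioc E₁ E₁', hooleySum g e (-(h : ℤ))‖)
        ≤ C * H₁ * (E₁ : ℝ) ^ (1 - η))
    (sgn : ℤ) (hsgn : sgn = 1 ∨ sgn = -1) :
    ∑ h ∈ Icc 1 H, ‖∑ e ∈ Ioc E E', trapCoef g Δ X₀ D e (sgn * h) * hooleySum g e (sgn * h)‖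
      ≤ ((D : ℝ) / 2 + (((D : ℝ) / (2 * Δ) + Real.pi / 8 * (((X₀ + D + 2 : ℕ) : ℝ)
            * (2 + D * C₁ / (2 * Δ * ((X₀ : ℝ) + 1)) + D * ((C₂ + 4 * C₁) / (2 * Δ * A))) + 4 * D) + D / 2)))
          * (C * (E : ℝ) ^ (1 - η) * (2 + Real.log H))
        + (Real.pi ^ 2 * D * ((X₀ + D + 3 : ℕ) : ℝ) / 4) * (C * H * (E : ℝ) ^ (1 - η)) / (E : ℝ) ^ 2 := by
  have hpow0 : 0 ≤ (E : ℝ) ^ (1 - η) := Real.rpow_nonneg (Nat.cast_nonneg _) _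
  have hC₁0 : 0 ≤ C₁ := by have := hC₁ 1 le_rfl; simp at this; exact (abs_nonneg _).trans this
  have hC₂0 : 0 ≤ C₂ := by have := hC₂ 1 le_rfl; simp at this; exact (abs_nonneg _).trans this
  have habs : ∀ h : ℕ, |sgn * (h : ℤ)| = h := by intro h; rcases hsgn with rfl | rfl <;> simp
  have hcast : ∀ h : ℕ, |((sgn * (h : ℤ) : ℤ) : ℝ)| = h := fun h => by exact_mod_cast habs h
  -- partial-sum bounds from the hypothesis
  have hT₀' : ∀ t ∈ Icc E E', ∀ H' : ℕ, H' ≤ H →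
      ∑ h ∈ Icc 1 H', ‖∑ i ∈ Ioc E t, hooleySum g i (sgn * h)‖ ≤ C * (E : ℝ) ^ (1 - η) * H' := by
    intro t ht H' hH'
    rw [mem_Icc] at ht
    have hH'θ : (H' : ℝ) ≤ (E : ℝ) ^ θ := le_trans (by exact_mod_cast hH') hHθ
    have key := hC E t H' hE ht.1 (ht.2.trans hE'2) hH'θ
    have hle : ∑ h ∈ Icc 1 H', ‖∑ i ∈ Ioc E t, hooleySum g i (sgn * h)‖
        ≤ ∑ h ∈ Icc 1 H', (‖∑ e ∈ Ioc E t, hooleySum g e h‖ + ‖∑ e ∈ Ioc E t, hooleySum g e (-(h : ℤ))‖) := by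
      refine sum_le_sum fun h _ => ?_
      rcases hsgn with rfl | rfl
      · simp only [one_mul]; linarith [norm_nonneg (∑ e ∈ Ioc E t, hooleySum g e (-(h : ℤ)))]
      · simp only [neg_mul, one_mul]; linarith [norm_nonneg (∑ e ∈ Ioc E t, hooleySum g e h)]
    refine hle.trans (key.trans (le_of_eq (by ring)))
  have hW₁0 : 0 ≤ (D : ℝ) / (2 * Δ) + Real.pi / 8 * (((X₀ + D + 2 : ℕ) : ℝ)
      * (2 + D * C₁ / (2 * Δ * ((X₀ : ℝ) + 1)) + D * ((C₂ + 4 * C₁) / (2 * Δ * A))) + 4 * D) + D / 2 := by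
    positivity
  have key := sum_norm_sum_Ioc_mul_le_of_factorised (fun e h => trapCoef g Δ X₀ D e (sgn * h))
    (fun e h => hooleySum g e (sgn * h)) (H := H) hE hEE' hE'2 (B₀ := (D : ℝ) / 2)
    (W₁ := (D : ℝ) / (2 * Δ) + Real.pi / 8 * (((X₀ + D + 2 : ℕ) : ℝ)
      * (2 + D * C₁ / (2 * Δ * ((X₀ : ℝ) + 1)) + D * ((C₂ + 4 * C₁) / (2 * Δ * A))) + 4 * D) + D / 2)
    (W₂ := Real.pi ^ 2 * D * ((X₀ + D + 3 : ℕ) : ℝ) / 4) (L₀ := C * H * (E : ℝ) ^ (1 - η))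
    (L₁ := C * (E : ℝ) ^ (1 - η) * (2 + Real.log H)) (by positivity) hW₁0 (by positivity)
    (by positivity) ?_ ?_ ?_ ?_ ?_
  · exact key.trans (le_of_eq (by ring))
  · -- `L₁ ≥ 0`
    have hlog : 0 ≤ Real.log (H : ℝ) := Real.log_natCast_nonneg H
    positivity
  · -- boundary coefficients
    intro h hh
    rw [mem_Icc] at hh
    have hh0 : sgn * (h : ℤ) ≠ 0 := by rcases hsgn with rfl | rfl <;> simp <;> omega
    have hh2 : 2 * |sgn * (h : ℤ)| ≤ (E' : ℤ) := by rw [habs]; exact_mod_cast (by omega : 2 * h ≤ E')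
    have := norm_trapCoef_le g hΔ X₀ D (hE.trans hEE') hz hA hmono (hvan E' hEE') hh0 hh2
    rw [hcast] at this
    simpa [div_div] using this
  · -- variation
    intro e he h hh
    rw [mem_Ioo] at he
    rw [mem_Icc] at hh
    have hh0 : sgn * (h : ℤ) ≠ 0 := by rcases hsgn with rfl | rfl <;> simp <;> omega
    have hh2 : 2 * |sgn * (h : ℤ)| ≤ (e : ℤ) := by rw [habs]; exact_mod_cast (by omega : 2 * h ≤ e)
    have := norm_trapCoef_succ_sub_le g hΔ X₀ D (by omega) hz hA hA1 hmono (hvan e he.1.le) hC₁ hC₂ hh0 hh2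
    rw [hcast] at this
    exact this.trans (le_of_eq (by ring))
  · -- harmonic weights
    intro t ht
    exact sum_div_le_of_partial_sums_le (x := fun h => ‖∑ i ∈ Ioc E t, hooleySum g i (sgn * h)‖)
      (by positivity) fun H' hH' => by
        rw [mem_Icc] at hH'
        have := hT₀' t ht H' hH'.2
        linarith
  · intro t ht
    have := hT₀' t ht H le_rfl
    linarith

/-! ### The tail -/
/-- **The frequency tail of the block**:
`‖∑_e (1/e)(∑_{H<h≤(e−1)/2} K_e(h)S + ∑_{H<k≤e/2} K_e(−k)S)‖ ≤ V·E'²·R/(4(H+1))`, `R = ∑_{E<e≤E'} ρ_g(e)/e`.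
[this work] -/
theorem norm_trapTail_le (g : ℤ[X]) {Δ : ℝ} (hΔ : 0 < Δ) (X₀ D : ℕ)
    (hz : ∀ k : ℕ, g.eval (k : ℤ) ≠ 0) {m₀ A : ℕ} (hA : m₀ ≤ A) (hA1 : 1 ≤ A)
    (hmono : ∀ m m' : ℕ, m₀ ≤ m → m ≤ m' → (g.eval (m : ℤ)).natAbs ≤ (g.eval (m' : ℤ)).natAbs)
    {C₁ C₂ : ℝ}
    (hC₁ : ∀ m : ℕ, 1 ≤ m →
      |Real.log ((g.eval ((m : ℤ) + 1)).natAbs : ℝ) - Real.log ((g.eval (m : ℤ)).natAbs : ℝ)| ≤ C₁ / m)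
    (hC₂ : ∀ m : ℕ, 1 ≤ m →
      |Real.log ((g.eval ((m : ℤ) + 2)).natAbs : ℝ) - 2 * Real.log ((g.eval ((m : ℤ) + 1)).natAbs : ℝ)
        + Real.log ((g.eval (m : ℤ)).natAbs : ℝ)| ≤ C₂ / (m : ℝ) ^ 2)
    {E E' H : ℕ} (hE : 1 ≤ E) (hvan : ∀ e : ℕ, E ≤ e → ∀ m : ℕ, m ≤ A + 1 → locWeight g Δ e m = 0) :
    ‖∑ e ∈ Ioc E E', 1 / (e : ℂ)
        * (∑ h ∈ Ioc H ((e - 1) / 2), trapKs g Δ X₀ D e h * hooleySum g e h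
          + ∑ k ∈ Ioc H (e / 2), trapKs g Δ X₀ D e (-(k : ℤ)) * hooleySum g e (-(k : ℤ)))‖
      ≤ (2 + D * C₁ / (2 * Δ * ((X₀ : ℝ) + 1)) + D * ((C₂ + 4 * C₁) / (2 * Δ * A))) * (E' : ℝ) ^ 2
          * (∑ e ∈ Ioc E E', (polyRootCountMod ![g] e : ℝ) / e) / (4 * ((H : ℝ) + 1)) := by
  set V : ℝ := 2 + D * C₁ / (2 * Δ * ((X₀ : ℝ) + 1)) + D * ((C₂ + 4 * C₁) / (2 * Δ * A)) with hVdef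
  have hpt : ∀ e ∈ Ioc E E',
      ‖1 / (e : ℂ) * (∑ h ∈ Ioc H ((e - 1) / 2), trapKs g Δ X₀ D e h * hooleySum g e h
          + ∑ k ∈ Ioc H (e / 2), trapKs g Δ X₀ D e (-(k : ℤ)) * hooleySum g e (-(k : ℤ)))‖
        ≤ V * (E' : ℝ) ^ 2 / (4 * ((H : ℝ) + 1)) * ((polyRootCountMod ![g] e : ℝ) / e) := by
    intro e he
    rw [mem_Ioc] at he
    have he1 : 1 ≤ e := by omega
    have he' : (0 : ℝ) < e := by exact_mod_cast he1
    set ρ : ℝ := (polyRootCountMod ![g] e : ℝ) with hρ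
    have hρ0 : 0 ≤ ρ := Nat.cast_nonneg _
    have hV := sum_norm_bdiff_bdiff_trapPhi_le g hΔ X₀ D he1 hz hA hA1 hmono (hvan e he.1.le) hC₁ hC₂
    have htail := sum_norm_kernelSum_tail_le (X₀ + D + 2) (trapPhi_top g Δ X₀ D e).1 (trapPhi_top g Δ X₀ D e).2
      hV (e := e) (H := H) (M₁ := (e - 1) / 2) (M₂ := e / 2) (by omega) (by omega)
    have hin : ‖∑ h ∈ Ioc H ((e - 1) / 2), trapKs g Δ X₀ D e h * hooleySum g e h
          + ∑ k ∈ Ioc H (e / 2), trapKs g Δ X₀ D e (-(k : ℤ)) * hooleySum g e (-(k : ℤ))‖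
        ≤ ρ * (V * (e : ℝ) ^ 2 / (4 * ((H : ℝ) + 1))) := by
      refine (norm_add_le _ _).trans ?_
      have b1 : ‖∑ h ∈ Ioc H ((e - 1) / 2), trapKs g Δ X₀ D e h * hooleySum g e h‖
          ≤ ρ * ∑ h ∈ Ioc H ((e - 1) / 2), ‖kernelSum (X₀ + D + 2) (trapPhi g Δ X₀ D e) (eAdd e (-(h : ℤ)))‖ := by
        rw [mul_sum]
        refine (norm_sum_le _ _).trans (sum_le_sum fun h _ => ?_)
        rw [norm_mul, mul_comm]
        exact mul_le_mul_of_nonneg_right (norm_hooleySum_le g e _) (norm_nonneg _)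
      have b2 : ‖∑ k ∈ Ioc H (e / 2), trapKs g Δ X₀ D e (-(k : ℤ)) * hooleySum g e (-(k : ℤ))‖
          ≤ ρ * ∑ k ∈ Ioc H (e / 2), ‖kernelSum (X₀ + D + 2) (trapPhi g Δ X₀ D e) (eAdd e (-(-(k : ℤ))))‖ := by
        rw [mul_sum]
        refine (norm_sum_le _ _).trans (sum_le_sum fun k _ => ?_)
        rw [norm_mul, mul_comm]
        exact mul_le_mul_of_nonneg_right (norm_hooleySum_le g e _) (norm_nonneg _)
      calc _ ≤ ρ * ∑ h ∈ Ioc H ((e - 1) / 2), ‖kernelSum (X₀ + D + 2) (trapPhi g Δ X₀ D e) (eAdd e (-(h : ℤ)))‖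
            + ρ * ∑ k ∈ Ioc H (e / 2), ‖kernelSum (X₀ + D + 2) (trapPhi g Δ X₀ D e) (eAdd e (-(-(k : ℤ))))‖ :=
            add_le_add b1 b2
        _ = ρ * (∑ h ∈ Ioc H ((e - 1) / 2), ‖kernelSum (X₀ + D + 2) (trapPhi g Δ X₀ D e) (eAdd e (-(h : ℤ)))‖
            + ∑ k ∈ Ioc H (e / 2), ‖kernelSum (X₀ + D + 2) (trapPhi g Δ X₀ D e) (eAdd e (-(-(k : ℤ))))‖) := by
            ring
        _ ≤ ρ * (V * (e : ℝ) ^ 2 / (4 * ((H : ℝ) + 1))) := mul_le_mul_of_nonneg_left htail hρ0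
    rw [norm_mul, norm_div, norm_one, Complex.norm_natCast]
    calc 1 / (e : ℝ) * ‖∑ h ∈ Ioc H ((e - 1) / 2), trapKs g Δ X₀ D e h * hooleySum g e h
            + ∑ k ∈ Ioc H (e / 2), trapKs g Δ X₀ D e (-(k : ℤ)) * hooleySum g e (-(k : ℤ))‖
        ≤ 1 / (e : ℝ) * (ρ * (V * (e : ℝ) ^ 2 / (4 * ((H : ℝ) + 1)))) :=
          mul_le_mul_of_nonneg_left hin (by positivity)
      _ = V * ((e : ℝ) * e) / (4 * ((H : ℝ) + 1)) * (ρ / e) := by field_simp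
      _ ≤ V * ((E' : ℝ) * E') / (4 * ((H : ℝ) + 1)) * (ρ / e) := by
          have hV0 : 0 ≤ V := le_trans (sum_nonneg fun _ _ => norm_nonneg _) hV
          have heE : (e : ℝ) ≤ E' := by exact_mod_cast he.2
          gcongr
      _ = V * (E' : ℝ) ^ 2 / (4 * ((H : ℝ) + 1)) * (ρ / e) := by rw [sq]
  refine (norm_sum_le _ _).trans ((sum_le_sum hpt).trans (le_of_eq ?_))
  rw [← mul_sum]
  ring

/-! ### The block estimate -/
/-- **THE BLOCK ESTIMATE** of the trapezoid method:
`‖Z(E,E']‖ ≤ 2·[(D/2 + W₁)·C E^{1−η}(2 + log H) + W₂·C H E^{1−η}/E²] + V·E'²·R/(4(H+1))`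
(`1 ≤ E ≤ E' ≤ 2E`, `2H + 1 ≤ E`, `H ≤ E^θ`; see the module docstring for `W₁, W₂, V, R`). [this work] -/
theorem norm_trapBlock_le (g : ℤ[X]) {Δ : ℝ} (hΔ : 0 < Δ) (X₀ D : ℕ)
    (hz : ∀ k : ℕ, g.eval (k : ℤ) ≠ 0) {m₀ A : ℕ} (hA : m₀ ≤ A) (hA1 : 1 ≤ A)
    (hmono : ∀ m m' : ℕ, m₀ ≤ m → m ≤ m' → (g.eval (m : ℤ)).natAbs ≤ (g.eval (m' : ℤ)).natAbs)
    {C₁ C₂ : ℝ}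
    (hC₁ : ∀ m : ℕ, 1 ≤ m →
      |Real.log ((g.eval ((m : ℤ) + 1)).natAbs : ℝ) - Real.log ((g.eval (m : ℤ)).natAbs : ℝ)| ≤ C₁ / m)
    (hC₂ : ∀ m : ℕ, 1 ≤ m →
      |Real.log ((g.eval ((m : ℤ) + 2)).natAbs : ℝ) - 2 * Real.log ((g.eval ((m : ℤ) + 1)).natAbs : ℝ)
        + Real.log ((g.eval (m : ℤ)).natAbs : ℝ)| ≤ C₂ / (m : ℝ) ^ 2)
    {E E' H : ℕ} (hE : 1 ≤ E) (hEE' : E ≤ E') (hE'2 : E' ≤ 2 * E) (hH : 2 * H + 1 ≤ E)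
    (hvan : ∀ e : ℕ, E ≤ e → ∀ m : ℕ, m ≤ A + 1 → locWeight g Δ e m = 0)
    {C θ η : ℝ} (hC0 : 0 ≤ C) (hHθ : (H : ℝ) ≤ (E : ℝ) ^ θ)
    (hC : ∀ E₁ E₁' H₁ : ℕ, 1 ≤ E₁ → E₁ ≤ E₁' → E₁' ≤ 2 * E₁ → (H₁ : ℝ) ≤ (E₁ : ℝ) ^ θ →
      ∑ h ∈ Icc 1 H₁, (‖∑ e ∈ Ioc E₁ E₁', hooleySum g e h‖ + ‖∑ e ∈ Ioc E₁ E₁', hooleySum g e (-(h : ℤ))‖)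
        ≤ C * H₁ * (E₁ : ℝ) ^ (1 - η)) :
    ‖∑ e ∈ Ioc E E', 1 / (e : ℂ) * ∑ h ∈ Ico 1 e, trapKernel g Δ X₀ D e h * hooleySum g e h‖
      ≤ 2 * (((D : ℝ) / 2 + (((D : ℝ) / (2 * Δ) + Real.pi / 8 * (((X₀ + D + 2 : ℕ) : ℝ)
              * (2 + D * C₁ / (2 * Δ * ((X₀ : ℝ) + 1)) + D * ((C₂ + 4 * C₁) / (2 * Δ * A))) + 4 * D) + D / 2)))
            * (C * (E : ℝ) ^ (1 - η) * (2 + Real.log H))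
          + (Real.pi ^ 2 * D * ((X₀ + D + 3 : ℕ) : ℝ) / 4) * (C * H * (E : ℝ) ^ (1 - η)) / (E : ℝ) ^ 2)
        + (2 + D * C₁ / (2 * Δ * ((X₀ : ℝ) + 1)) + D * ((C₂ + 4 * C₁) / (2 * Δ * A))) * (E' : ℝ) ^ 2
          * (∑ e ∈ Ioc E E', (polyRootCountMod ![g] e : ℝ) / e) / (4 * ((H : ℝ) + 1)) := by
  have hvan0 : ∀ e : ℕ, E < e → locWeight g Δ e 0 = 0 := fun e he => hvan e he.le 0 (by omega)
  rw [trapBlock_eq g Δ X₀ D hH hvan0]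
  have hplus := sum_norm_trapMain_le g hΔ X₀ D hz hA hA1 hmono hC₁ hC₂ hE hEE' hE'2 hH hvan hC0 hHθ hC 1
    (Or.inl rfl)
  have hminus := sum_norm_trapMain_le g hΔ X₀ D hz hA hA1 hmono hC₁ hC₂ hE hEE' hE'2 hH hvan hC0 hHθ hC (-1)
    (Or.inr rfl)
  simp only [one_mul] at hplus
  simp only [neg_mul, one_mul] at hminus
  have htail := norm_trapTail_le g hΔ X₀ D hz hA hA1 hmono hC₁ hC₂ (E' := E') (H := H) hE hvan
  refine (norm_add_le _ _).trans ?_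
  refine (add_le_add ((norm_add_le _ _).trans (add_le_add (norm_sum_le _ _) (norm_sum_le _ _))) htail).trans ?_
  linarith

end Summit.Parity.BatemanHorn.Theorems
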